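import Mathlib

/-!
# Sketch (crux-ideate stmt-Parity-0870, ideator 6, round 2) — the Farey-triangle sign anchor

First lemmas of the idea card `farey-triangle-sign-anchor` typed over Mathlib only.
The crux `PolyMobiusTail` itself is NOT restated here (it is Λ-Bateman–Horn for every system;
`Negative/Equivalence.polyMobiusTail_iff_lambdaBatemanHorn`). The lever is the exact square law
`f(n+e)·f(n+C) = f(n)·(2n+e+C)²` for every factorisation `f(n) = e·C` of `f = X²+1` (and its
analogue for every monic quadratic), i.e. the hyperedges `{n, n+e, n+C}` = the images
`{u·v, u·(u+v), (u+v)·v}` of a Farey triangle `(u, v, u+v)` of primitive vectors under the dot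
product. Consequence (pigeonhole on three signs): `λ(f(·)) = +1` on a transversal of this
3-uniform hypergraph, which has `≍ x` edges below `x`.
-/

namespace Summit.Parity.BatemanHorn.Cruxes.PolyMobiusTail.FareyTriangle

open Finset Filter ArithmeticFunction

/-- The square law behind the hyperedge `{n, n+e, n+C}` for `f = X² + 1`:
if `e·C = n²+1` then `f(n+e)·f(n+C) = f(n)·(2n+e+C)²` (so the three Liouville values multiply
to `+1`). Proved: a polynomial identity modulo the hypothesis. -/
theorem sq_law (n e C : ℤ) (h : e * C = n ^ 2 + 1) :
    ((n + e) ^ 2 + 1) * ((n + C) ^ 2 + 1) = (n ^ 2 + 1) * (2 * n + e + C) ^ 2 := by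
  linear_combination (e * C - (n ^ 2 + 1) - (2 * n + e + C) * (e + C) + (2 * n + e + C) ^ 2) * h

/-- The same law for an arbitrary monic quadratic `f = X² + bX + d`:
if `A·C = f(c)` then `f(c+A)·f(c+C) = f(c)·(2c+A+C+b)²`. -/
theorem sq_law_monicQuadratic (b d c A C : ℤ) (h : A * C = c ^ 2 + b * c + d) :
    ((c + A) ^ 2 + b * (c + A) + d) * ((c + C) ^ 2 + b * (c + C) + d)
      = (c ^ 2 + b * c + d) * (2 * c + A + C + b) ^ 2 := by
  linear_combination
    (A * C - (c ^ 2 + b * c + d) - (2 * c + A + C + b) * (A + C) + (2 * c + A + C + b) ^ 2) * h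

/-- The hyperedge set of `H_x` for `f = X²+1`, as pairs `(n, e)` with `e ∣ n²+1`, `e` the SMALLER
factor (`e² < n²+1`), and the largest vertex `n + (n²+1)/e ≤ x`; the edge is `{n, n+e, n+(n²+1)/e}`. -/
def edgePairs (x : ℕ) : Finset (ℕ × ℕ) :=
  ((Icc 1 x) ×ˢ (Icc 1 x)).filter
    (fun p => p.2 ∣ p.1 ^ 2 + 1 ∧ p.2 ^ 2 < p.1 ^ 2 + 1 ∧ p.1 + (p.1 ^ 2 + 1) / p.2 ≤ x)

/-- (E) Linear edge count: `#E(H_x) ≥ c·x` eventually. Informal proof: moduli `A ∈ [x/6, x/4]`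
and roots `c ∈ [1, A]` of `c² ≡ -1 (mod A)` give distinct admissible pairs, so
`#E(H_x) ≥ ½ ∑_{x/6 ≤ A ≤ x/4} ρ(A) ≍ x` by the mean value of the root count `ρ = ρ_{X²+1}`
(no equidistribution of roots needed). Numerics: `#E(H_x)/x = 0.324, 0.331, 0.331, 0.332` at
`x = 10³, 10⁴, 10⁵, 3·10⁵`. -/
def EdgeCountLower : Prop :=
  ∃ c : ℝ, 0 < c ∧ ∀ᶠ x : ℕ in atTop, c * (x : ℝ) ≤ ((edgePairs x).card : ℝ)

/-- (M) Second moment of the divisor function along `n²+1` (Nair 1992 / Nair–Tenenbaum 1998 class;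
`τ(n²+1)²` is a sub-multiplicative function of the value): `∑_{n≤x} τ(n²+1)² ≪ x (log x)³`.
It bounds `∑_v deg_{H_x}(v)²` since `deg(v) ≤ 3τ(v²+1)`. (The window-restricted second moment
is numerically `≈ 0.54·x·log x`, which would upgrade (A) to `x/log x`.) -/
def TauSqAlongPoly : Prop :=
  ∃ C : ℝ, ∀ᶠ x : ℕ in atTop,
    (∑ n ∈ Icc 1 x, (((n ^ 2 + 1).divisors.card : ℝ)) ^ 2) ≤ C * x * Real.log x ^ 3

/-- (A) FIRST LEMMA of the card (theorem-grade target, believed new): `+1`-abundance of the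
Liouville function at `n² + 1`: `#{n ≤ x : λ(n²+1) = +1} ≫ x/(log x)³`.
Proof sketch: `{n : λ(n²+1) = 1}` meets every hyperedge (three signs with product `+1` are not
all `-1`, by `sq_law` and complete multiplicativity of `λ`), and a transversal `P` of a
hypergraph satisfies `#E ≤ ∑_{v∈P} deg v ≤ √#P · √(∑ deg²)`; combine (E) and (M). -/
def PlusSignAbundance : Prop :=
  ∃ c : ℝ, 0 < c ∧ ∀ᶠ x : ℕ in atTop,
    c * (x : ℝ) / Real.log x ^ 3 ≤
      (((Icc 1 x).filter (fun n => ArithmeticFunction.liouville (n ^ 2 + 1) = 1)).card : ℝ)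

/-- (A') The same for EVERY completely multiplicative `g : ℕ → {±1}` (the argument uses nothing
about `λ` except complete multiplicativity and `g(m²) = 1`), and for every monic irreducible
quadratic with positive values — stated here for `X² + 1`. -/
def PlusSignAbundanceCM : Prop :=
  ∀ g : ℕ → ℤ, (∀ m n : ℕ, 1 ≤ m → 1 ≤ n → g (m * n) = g m * g n) →
    (∀ n : ℕ, 1 ≤ n → g n = 1 ∨ g n = -1) →
      ∃ c : ℝ, 0 < c ∧ ∀ᶠ x : ℕ in atTop,
        c * (x : ℝ) / Real.log x ^ 3 ≤ (((Icc 1 x).filter (fun n => g (n ^ 2 + 1) = 1)).card : ℝ)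

/-- The elementary transversal inequality used (pure combinatorics): if every member of a family
`E` of 3-element subsets of `V` meets `P`, then `#E ≤ ∑_{v ∈ P} deg v`, where
`deg v = #{T ∈ E : v ∈ T}`; with Cauchy–Schwarz `#E² ≤ #P · ∑_v (deg v)²`. -/
theorem card_le_sum_deg {V : Type*} [DecidableEq V] (E : Finset (Finset V)) (P : Finset V)
    (hmeet : ∀ T ∈ E, ∃ v ∈ P, v ∈ T) :
    E.card ≤ ∑ v ∈ P, (E.filter (fun T => v ∈ T)).card := by
  classical
  calc E.card = ∑ T ∈ E, 1 := by simp
    _ ≤ ∑ T ∈ E, ∑ v ∈ P, (if v ∈ T then 1 else 0) := by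
        apply Finset.sum_le_sum
        intro T hT
        obtain ⟨v, hvP, hvT⟩ := hmeet T hT
        calc (1 : ℕ) = if v ∈ T then 1 else 0 := by simp [hvT]
          _ ≤ ∑ w ∈ P, (if w ∈ T then 1 else 0) :=
            Finset.single_le_sum (f := fun w => if w ∈ T then 1 else 0) (by intros; positivity) hvP
    _ = ∑ v ∈ P, ∑ T ∈ E, (if v ∈ T then 1 else 0) := Finset.sum_comm
    _ = ∑ v ∈ P, (E.filter (fun T => v ∈ T)).card := by
        apply Finset.sum_congr rfl
        intro v _
        rw [Finset.card_filter]

end Summit.Parity.BatemanHorn.Cruxes.PolyMobiusTail.FareyTriangle
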